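import Summits.QuantumFields.BalabanUV.Beta.AveragingBorderLoops
import Summits.QuantumFields.BalabanUV.Beta.SecondOrderBorderNoModelWitness

/-!
# `BalabanUV.Beta.AveragingBorderWitness` — binder row D1, (L4): **A NON-ZERO FIELD–MULTIPLIER ENTRY OF THE CENTRE-ROOTED
# FIRST-ORDER BORDER TABLE** `vhSAt ρ_c` (part 2 of 2 of the counting witness `vhSAt_ne_zero` WANTED by the row-D1 owner an2-g19,
# journal l.13361 (3)) **AND THE KERNEL FORM OF I-d1ref11-1: NO TWIN MODEL OF THE BORDER SOCKET AT LEVEL 0**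
# (`SecondOrderBorderNoModel.no_twin_border_model` APPLIED at `j = 0`, `α = τ`, the centred root, any `cVH ≠ 0`, `γ 0 ≠ 0`)

HONEST FRAMING (cell charter, verbatim): «discharging BetaPertH makes Balaban's UV stability UNCONDITIONAL — a real
constructive-QFT result; it is NOT the continuum limit and NOT the Clay problem.»  This module is [folklore] `Finset` combinatorics
and one-line kernel algebra over an1's node-7aρ objects (`vhSAt`, `vhKerAt`, `vhCountAt`, `hessCountAt`, `linCountAt`, `cCountAt`,
`packVH`), part 1 `Beta.AveragingBorderLoops`, an2's (W-D) `SpineRooted.SpureRecAt` (member `0` = `cE • wilsonA + cVH • vhSAt ρ`) and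
an2's K-E `SecondOrderBorderNoModel.no_twin_border_model`, all BY NAME and never restated; no statement of Bałaban's papers, no
`[cite:]`, no `def`, no `Prop` fact; it instantiates NO binder of the wall (0/4: hW, hR, D1Tel, D1Rep) — it shows that ONE candidate
packing of the border letter (a TWIN `vh₂S` with a parity-odd residual) is VACUOUS, which is what referee #11 I-d1ref11-1 asked to
have in the kernel.  NOT D1, NOT `BetaPertH`, NOT continuum, NOT Clay.
HONEST DEPENDENCY: continuum YM on T⁴ ⇐ BetaPertH ∧ nine spine estimates (0/9 proved); BetaPertH ⇐ (D1) ∧ (D4) ∧ CAP+tail;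
G-an2-4 gates asym, D1 and NE2/3/4.

## What is proved (node-5 dimension `e + 3` = an2's `d + 1` with `d = e + 2 ≥ 2`; ANY block size `2 ≤ L`, odd or even; root
## `ρ_c = toSite (ctrOff (e+3) L)`; `τ = e + 2`, `σ = e + 1`, `μ ∉ {τ, σ}`)
* §3 `hessCountAt ρ_c L μ 0 (τ,ρ_c) (σ,ρ_c) = 0` (no loop carries both bonds, part 1); the EXACT linear counts
  `linCountAt ρ_c L μ 0 (τ,ρ_c) = #{b : c < b τ} = (L−1−c)·L^{e+2}`, `linCountAt ρ_c L μ 0 (σ,ρ_c) = #{b : b τ = c ∧ c < b σ} =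
  (L−1−c)·L^{e+1}` (`c = (L−1)/2`; both `> 0` iff `2 ≤ L`); hence by node 7aρ's closed form
  `vhCountAt ρ_c L μ 0 (τ,ρ_c) (σ,ρ_c) = −lin·lin′ = −(L−1−c)²·L^{2e+3} < 0`, `vhKerAt … ≠ 0`, THE EXACT ENTRY
  `vhSAt ρ_c (e+2) L rfl σ ρ_c ρ_c 0 (inl τ) (inr μ) = −(L−1−c)²·L^{2e+3}/(2L^{2(e+3)})` (`= −(L−1−c)²/(2L³)`) and
  **`vhSAt (toSite (ctrOff (e+3) L)) (e+2) L rfl σ ρ_c ρ_c 0 (inl τ) (inr μ) ≠ 0`** (`κ′ = σ ≠ α = τ`, `m = μ ≠ α`) — with the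
  `∃`-form in the binder shape of `no_twin_border_model` and the wall's `d = 3` instance (`α = 3`, `κ′ = 2`, `m = 0`).
* §4 (generalising an2's `SecondOrderBorderNoModelWitness` p219249, which DECIDES the single case `Lc = 3` at `α = 2`) the same entry of
  an2's level-0 pure table: `SpureRecAt (e+2) L ρ_c cE cVH cΛ 0 σ ρ_c ρ_c 0 (inl τ) (inr μ) = cVH · (that entry)
  ≠ 0` for `cVH ≠ 0` (the Wilson table is zero on the border); and **`no_twin_border_model_zero`**: for `2 ≤ L`, `cVH ≠ 0`,
  `γ 0 ≠ 0`, a border-TWIN `vh₂S` and ANY coefficient `b`, there is NO parity-odd `RB` with both border blocks (hBfm)/(hBmf) of the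
  hR END's letter at `(j, α) = (0, τ)` — `no_twin_border_model` applied to the §3 witness (+ the `d = 3` instance); and
  **`final_border_socket_no_twin_model`** = an2's `final_border_socket_no_twin_model_Lc3` with `3 ↦ Lc`, EVERY `2 ≤ Lc` (the END's border
  socket family ∀ j α with the wall's pins `cE = Lc⁴`, `cVH = −Lc⁸/2`, `γ_j`, weights `cB·wB2 j` ⇒ `False` for any border-twin `vh₂S`).
Provenance: β sub-cell, D1 formalisation swarm, unit b2b-balaban-beta-d1-formalise-leaf-04 gen 3, 2026-08-20 (v1); no existing file
touched.
-/

open Finset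
open Literature.MathematicalPhysics.QuantumFieldTheory.Balaban1983to89.Beta
open Literature.MathematicalPhysics.QuantumFieldTheory.Balaban1983to89.Beta.AffineAveraging
open Literature.MathematicalPhysics.QuantumFieldTheory.Balaban1983to89.Beta.AveragingContours
open Literature.MathematicalPhysics.QuantumFieldTheory.Balaban1983to89.Beta.AveragingContoursRooted
open Literature.MathematicalPhysics.QuantumFieldTheory.Balaban1983to89.Beta.TransportedContourVariables
open Literature.MathematicalPhysics.QuantumFieldTheory.Balaban1983to89.Beta.AveragingHessianKernels
open Literature.MathematicalPhysics.QuantumFieldTheory.Balaban1983to89.Beta.AveragingHessianKernelsRooted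
open Summit.QuantumFields.BalabanUV.Beta.AveragingBorderLoops

namespace Summit.QuantumFields.BalabanUV.Beta.AveragingBorderWitness

/-! ## §3 The kernels at the two root bonds and the non-zero border entry -/

section Witness

variable {e L : ℕ} {τ σ μ : Fin (e + 3)}

/-- [folklore] **NO LOOP CARRIES BOTH ROOT BONDS ⇒ THE ROOTED W-HESSIAN COUNT VANISHES**:
`hessCountAt ρ_c L μ 0 (τ, ρ_c) (σ, ρ_c) = 0` (`μ ∉ {τ, σ}`). -/
theorem hessCountAt_ctr_eq_zero (hL : 1 ≤ L) (hτ : (τ : ℕ) = e + 2) (hσ : (σ : ℕ) = e + 1) (hμτ : μ ≠ τ)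
    (hμσ : μ ≠ σ) : hessCountAt (ctr (e + 3) L) L μ 0 (τ, ctr (e + 3) L) (σ, ctr (e + 3) L) = 0 := by
  have h1 : ∀ b ∈ box (e + 3) L,
      wedge (loopCAt (ctr (e + 3) L) (pairForm (δ1 (τ, ctr (e + 3) L)) (δ1 (σ, ctr (e + 3) L))) L μ 0 b) = 0 := by
    intro b _
    by_cases hc : (((L - 1) / 2 : ℕ) : ℤ) < (b τ : ℤ)
    · exact wedge_eq_zero_of_snd _ (snd_loopCAt_eq_zero (loopCAt_δ1_second hL hτ hσ hμσ b (ne_of_gt hc)))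
    · exact wedge_eq_zero_of_fst _ (fst_loopCAt_eq_zero (loopCAt_δ1_last hL hτ hμτ b hc))
  have h2 : wedge (segUp (pairForm (δ1 (τ, ctr (e + 3) L)) (δ1 (σ, ctr (e + 3) L)))
      ((L : ℤ) • (0 : Site (e + 3)) + ctr (e + 3) L) μ L) = 0 := by
    refine wedge_eq_zero_of_fst _ fun p hp => ?_
    have hp' : p.1 ∈ bg (segUp (pairForm (δ1 (τ, ctr (e + 3) L)) (δ1 (σ, ctr (e + 3) L)))
        ((L : ℤ) • (0 : Site (e + 3)) + ctr (e + 3) L) μ L) := List.mem_map.2 ⟨p, hp, rfl⟩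
    rw [bg_segUp_pairForm] at hp'
    exact segUp_δ1_of_ne (g := (τ, ctr (e + 3) L)) (Ne.symm hμτ) _ _ _ hp'
  have h3 : cCountAt (ctr (e + 3) L) L μ 0 (τ, ctr (e + 3) L) = 0 :=
    sum_eq_zero_of_forall (segUp_δ1_of_ne (g := (τ, ctr (e + 3) L)) (Ne.symm hμτ) _ _)
  have h4 : cCountAt (ctr (e + 3) L) L μ 0 (σ, ctr (e + 3) L) = 0 :=
    sum_eq_zero_of_forall (segUp_δ1_of_ne (g := (σ, ctr (e + 3) L)) (Ne.symm hμσ) _ _)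
  rw [hessCountAt, Finset.sum_eq_zero h1, h2, h3, h4]
  ring

/-- [folklore] Counting over the box, last axis: `Σ_{b ∈ box} [c < b τ] = (L − 1 − c) · L^{e+2}`. -/
theorem sum_box_indicator_last (e L c : ℕ) (τ : Fin (e + 3)) :
    (∑ b ∈ box (e + 3) L, (if (c : ℤ) < (b τ : ℤ) then (1 : ℤ) else 0)) = ((L - 1 - c : ℕ) : ℤ) * (L : ℤ) ^ (e + 2) := by
  have h1 : (∑ b ∈ box (e + 3) L, (if (c : ℤ) < (b τ : ℤ) then (1 : ℤ) else 0))
      = ∏ i : Fin (e + 3), ∑ y ∈ range L, (if i = τ then (if (c : ℤ) < (y : ℤ) then (1 : ℤ) else 0) else 1) := by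
    rw [Finset.prod_univ_sum]
    refine Finset.sum_congr rfl fun b _ => ?_
    rw [Finset.prod_ite_eq']
    simp
  have h2 : ∏ i ∈ univ \ {τ}, ∑ y ∈ range L, (if i = τ then (if (c : ℤ) < (y : ℤ) then (1 : ℤ) else 0) else 1) =
      (L : ℤ) ^ (e + 2) := by
    rw [Finset.prod_congr rfl (g := fun _ => (L : ℤ))]
    · rw [Finset.prod_const, Finset.card_sdiff_of_subset (Finset.subset_univ _), Finset.card_univ, Fintype.card_fin,
        Finset.card_singleton, show e + 3 - 1 = e + 2 from rfl]
    · intro i hi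
      rw [Finset.mem_sdiff, Finset.mem_singleton] at hi
      simp [if_neg hi.2]
  have h3 : ∑ y ∈ range L, (if (c : ℤ) < (y : ℤ) then (1 : ℤ) else 0) = ((L - 1 - c : ℕ) : ℤ) := by
    rw [Finset.sum_boole]
    have : (range L).filter (fun y : ℕ => (c : ℤ) < (y : ℤ)) = Finset.Ico (c + 1) L := by
      ext y; simp [Finset.mem_Ico]; omega
    rw [this, Nat.card_Ico]
    omega
  rw [h1, Finset.prod_eq_mul_prod_sdiff_singleton_of_mem (Finset.mem_univ τ), h2]
  simp only [if_true]
  rw [h3]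

/-- [folklore] Counting over the box, last two axes: `Σ_{b ∈ box} [b τ = c ∧ c < b σ] = (L − 1 − c) · L^{e+1}` (`c < L`, `σ ≠ τ`). -/
theorem sum_box_indicator_second (e : ℕ) {L c : ℕ} (hc : c < L) {τ σ : Fin (e + 3)} (hστ : σ ≠ τ) :
    (∑ b ∈ box (e + 3) L, (if (b τ : ℤ) = (c : ℤ) ∧ (c : ℤ) < (b σ : ℤ) then (1 : ℤ) else 0)) =
      ((L - 1 - c : ℕ) : ℤ) * (L : ℤ) ^ (e + 1) := by
  have h1 : (∑ b ∈ box (e + 3) L, (if (b τ : ℤ) = (c : ℤ) ∧ (c : ℤ) < (b σ : ℤ) then (1 : ℤ) else 0))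
      = ∏ i : Fin (e + 3), ∑ y ∈ range L,
          (if i = τ then (if (y : ℤ) = (c : ℤ) then (1 : ℤ) else 0) else if i = σ then (if (c : ℤ) < (y : ℤ) then 1 else 0) else 1) := by
    rw [Finset.prod_univ_sum]
    refine Finset.sum_congr rfl fun b _ => ?_
    rw [Finset.prod_eq_mul_prod_sdiff_singleton_of_mem (Finset.mem_univ τ), if_pos rfl,
      Finset.prod_eq_mul_prod_sdiff_singleton_of_mem (i := σ) (by simp [hστ]), if_neg hστ, if_pos rfl,
      Finset.prod_eq_one (fun i hi => ?_)]
    · by_cases hb : (b τ : ℤ) = (c : ℤ) <;> by_cases hb' : (c : ℤ) < (b σ : ℤ) <;> simp [hb, hb']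
    · simp only [Finset.mem_sdiff, Finset.mem_singleton] at hi
      rw [if_neg hi.1.2, if_neg hi.2]
  have h2 : ∏ i ∈ (univ \ {τ}) \ {σ}, ∑ y ∈ range L,
      (if i = τ then (if (y : ℤ) = (c : ℤ) then (1 : ℤ) else 0) else if i = σ then (if (c : ℤ) < (y : ℤ) then 1 else 0) else 1) =
      (L : ℤ) ^ (e + 1) := by
    rw [Finset.prod_congr rfl (g := fun _ => (L : ℤ))]
    · rw [Finset.prod_const, Finset.card_sdiff_of_subset (by simp [hστ]), Finset.card_sdiff_of_subset (Finset.subset_univ _),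
        Finset.card_univ, Fintype.card_fin, Finset.card_singleton, Finset.card_singleton, show e + 3 - 1 - 1 = e + 1 from rfl]
    · intro i hi
      simp only [Finset.mem_sdiff, Finset.mem_singleton] at hi
      simp [if_neg hi.1.2, if_neg hi.2]
  have h3 : ∑ y ∈ range L, (if (c : ℤ) < (y : ℤ) then (1 : ℤ) else 0) = ((L - 1 - c : ℕ) : ℤ) := by
    rw [Finset.sum_boole]
    have : (range L).filter (fun y : ℕ => (c : ℤ) < (y : ℤ)) = Finset.Ico (c + 1) L := by
      ext y; simp [Finset.mem_Ico]; omega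
    rw [this, Nat.card_Ico]
    omega
  have h4 : ∑ y ∈ range L, (if (y : ℤ) = (c : ℤ) then (1 : ℤ) else 0) = 1 := by
    have : ∀ y : ℕ, (if (y : ℤ) = (c : ℤ) then (1 : ℤ) else 0) = if c = y then 1 else 0 := fun y => by
      by_cases h : c = y
      · rw [if_pos h, if_pos (by rw [h])]
      · rw [if_neg h, if_neg (fun h' => h (by exact_mod_cast h'.symm))]
    simp_rw [this]
    rw [Finset.sum_ite_eq, if_pos (Finset.mem_range.2 hc)]
  rw [h1, Finset.prod_eq_mul_prod_sdiff_singleton_of_mem (Finset.mem_univ τ),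
    Finset.prod_eq_mul_prod_sdiff_singleton_of_mem (i := σ) (by simp [hστ]), h2]
  simp only [if_true, if_neg hστ]
  rw [h3, h4, one_mul]

/-- [folklore] **THE EXACT LINEAR COUNTS**: `linCountAt ρ_c L μ 0 (τ,ρ_c) = (L−1−c)·L^{e+2}` and
`linCountAt ρ_c L μ 0 (σ,ρ_c) = (L−1−c)·L^{e+1}` (`c = (L−1)/2`, `1 ≤ L`). -/
theorem linCountAt_ctr_eq (hL : 1 ≤ L) (hτ : (τ : ℕ) = e + 2) (hσ : (σ : ℕ) = e + 1) (hμτ : μ ≠ τ) (hμσ : μ ≠ σ) :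
    linCountAt (ctr (e + 3) L) L μ 0 (τ, ctr (e + 3) L) = ((L - 1 - (L - 1) / 2 : ℕ) : ℤ) * (L : ℤ) ^ (e + 2) ∧
    linCountAt (ctr (e + 3) L) L μ 0 (σ, ctr (e + 3) L) = ((L - 1 - (L - 1) / 2 : ℕ) : ℤ) * (L : ℤ) ^ (e + 1) := by
  have hστ : σ ≠ τ := fun h => by have := congrArg Fin.val h; omega
  constructor
  · unfold linCountAt linAvgAt
    rw [Finset.sum_congr rfl fun b _ => sum_gammaCAt_δ1_last hL hτ hμτ b]
    exact sum_box_indicator_last e L _ τ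
  · unfold linCountAt linAvgAt
    rw [Finset.sum_congr rfl fun b _ => sum_gammaCAt_δ1_second hL hτ hσ hμσ b]
    exact sum_box_indicator_second e (by omega) hστ

/-- [folklore] **BOTH LINEAR COUNTS ARE POSITIVE** for `2 ≤ L` (`c = (L−1)/2 < L − 1`). -/
theorem linCountAt_ctr_pos (hL : 2 ≤ L) (hτ : (τ : ℕ) = e + 2) (hσ : (σ : ℕ) = e + 1) (hμτ : μ ≠ τ) (hμσ : μ ≠ σ) :
    0 < linCountAt (ctr (e + 3) L) L μ 0 (τ, ctr (e + 3) L) ∧ 0 < linCountAt (ctr (e + 3) L) L μ 0 (σ, ctr (e + 3) L) := by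
  obtain ⟨h1, h2⟩ := linCountAt_ctr_eq (L := L) (by omega) hτ hσ hμτ hμσ
  have hc : (0 : ℤ) < ((L - 1 - (L - 1) / 2 : ℕ) : ℤ) := by
    have : 0 < L - 1 - (L - 1) / 2 := by omega
    exact_mod_cast this
  have hL' : (0 : ℤ) < (L : ℤ) := by exact_mod_cast (by omega : 0 < L)
  rw [h1, h2]
  exact ⟨mul_pos hc (pow_pos hL' _), mul_pos hc (pow_pos hL' _)⟩

/-- [folklore] **THE ROOTED FIELD–MULTIPLIER COUNT AT THE TWO ROOT BONDS IS MINUS THE PRODUCT OF THE LINEAR COUNTS**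
(node 7aρ's closed form `vhCountAt = L^D·hessCountAt + L^D·[f = f′]·linCountAt − linCountAt ⊗ linCountAt` with the
first two terms zero). -/
theorem vhCountAt_ctr_eq (hL : 1 ≤ L) (hτ : (τ : ℕ) = e + 2) (hσ : (σ : ℕ) = e + 1) (hμτ : μ ≠ τ) (hμσ : μ ≠ σ) :
    vhCountAt (ctr (e + 3) L) L μ 0 (τ, ctr (e + 3) L) (σ, ctr (e + 3) L) =
      -(linCountAt (ctr (e + 3) L) L μ 0 (τ, ctr (e + 3) L) * linCountAt (ctr (e + 3) L) L μ 0 (σ, ctr (e + 3) L)) := by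
  have hστ : σ ≠ τ := fun h => by have := congrArg Fin.val h; omega
  have hne : ((τ, ctr (e + 3) L) : Bond (e + 3)) ≠ (σ, ctr (e + 3) L) := fun h => hστ (congrArg Prod.fst h).symm
  rw [vhCountAt, hessCountAt_ctr_eq_zero hL hτ hσ hμτ hμσ, if_neg hne]
  ring

/-- [folklore] **THE EXACT FIELD–MULTIPLIER COUNT**: `vhCountAt ρ_c L μ 0 (τ,ρ_c) (σ,ρ_c) = −(L−1−c)²·L^{2e+3}`. -/
theorem vhCountAt_ctr_eq_closed (hL : 1 ≤ L) (hτ : (τ : ℕ) = e + 2) (hσ : (σ : ℕ) = e + 1) (hμτ : μ ≠ τ)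
    (hμσ : μ ≠ σ) : vhCountAt (ctr (e + 3) L) L μ 0 (τ, ctr (e + 3) L) (σ, ctr (e + 3) L) =
      -(((L - 1 - (L - 1) / 2 : ℕ) : ℤ) ^ 2 * (L : ℤ) ^ (2 * e + 3)) := by
  obtain ⟨h1, h2⟩ := linCountAt_ctr_eq hL hτ hσ hμτ hμσ
  rw [vhCountAt_ctr_eq hL hτ hσ hμτ hμσ, h1, h2]
  ring

/-- [folklore] **… HENCE NEGATIVE** for `2 ≤ L`. -/
theorem vhCountAt_ctr_neg (hL : 2 ≤ L) (hτ : (τ : ℕ) = e + 2) (hσ : (σ : ℕ) = e + 1) (hμτ : μ ≠ τ) (hμσ : μ ≠ σ) :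
    vhCountAt (ctr (e + 3) L) L μ 0 (τ, ctr (e + 3) L) (σ, ctr (e + 3) L) < 0 := by
  obtain ⟨h1, h2⟩ := linCountAt_ctr_pos hL hτ hσ hμτ hμσ
  rw [vhCountAt_ctr_eq (by omega) hτ hσ hμτ hμσ, neg_lt_zero]
  exact mul_pos h1 h2

/-- [folklore] The rooted field–multiplier KERNEL `m^{ρ_c}` at the two root bonds is non-zero (`2 ≤ L`). -/
theorem vhKerAt_ctr_ne_zero (hL : 2 ≤ L) (hτ : (τ : ℕ) = e + 2) (hσ : (σ : ℕ) = e + 1) (hμτ : μ ≠ τ) (hμσ : μ ≠ σ) :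
    vhKerAt (ctr (e + 3) L) L μ 0 (τ, ctr (e + 3) L) (σ, ctr (e + 3) L) ≠ 0 := by
  have hL' : (L : ℝ) ≠ 0 := Nat.cast_ne_zero.2 (by omega)
  rw [vhKerAt]
  exact div_ne_zero (Int.cast_ne_zero.2 (vhCountAt_ctr_neg hL hτ hσ hμτ hμσ).ne)
    (mul_ne_zero two_ne_zero (pow_ne_zero _ hL'))

/-- [folklore] **THE EXACT ENTRY**: `vhSAt ρ_c (e+2) L rfl σ ρ_c ρ_c 0 (inl τ) (inr μ) = −(L−1−c)²·L^{2e+3} / (2·L^{2(e+3)})`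
(`= −(L−1−c)²/(2L³)`; for odd `L` this is `−(L−1)²/(8L³)`). -/
theorem vhSAt_ctr_eq (hL : 1 ≤ L) (hτ : (τ : ℕ) = e + 2) (hσ : (σ : ℕ) = e + 1) (hμτ : μ ≠ τ) (hμσ : μ ≠ σ) :
    vhSAt (toSite (ctrOff (e + 3) L)) (e + 2) L rfl σ (toSite (ctrOff (e + 3) L)) (toSite (ctrOff (e + 3) L)) 0
      (Sum.inl τ) (Sum.inr μ) =
      ((-(((L - 1 - (L - 1) / 2 : ℕ) : ℤ) ^ 2 * (L : ℤ) ^ (2 * e + 3)) : ℤ) : ℝ) / (2 * (L : ℝ) ^ (2 * (e + 3))) := by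
  have hoff : off L (0 : Site (e + 3)) = 0 := by funext i; simp [off]
  have hblk : blk L (0 : Site (e + 3)) = 0 := by funext i; simp [blk]
  unfold vhSAt
  rw [packVH_inl_inr, if_pos hoff, hblk]
  show vhKerAt (ctr (e + 3) L) L μ 0 (τ, ctr (e + 3) L) (σ, ctr (e + 3) L) = _
  rw [vhKerAt, vhCountAt_ctr_eq_closed hL hτ hσ hμτ hμσ]

/-- [folklore] **THE NON-ZERO BORDER ENTRY (an2's WANTED `vhSAt_ne_zero`)**: at the CENTRED root
`ρ_c = toSite (ctrOff (e+3) L)`, any `2 ≤ L`, the field–multiplier entry of the rooted border stencil with background bond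
`(σ, ρ_c)`, fluctuation leg `(ρ_c, inl τ)` and multiplier leg `(0, inr μ)` is non-zero — with `σ ≠ τ` (`κ′ ≠ α`) and
`μ ≠ τ` (`m ≠ α`) as `SecondOrderBorderNoModel.no_twin_border_model` requires. -/
theorem vhSAt_ctr_ne_zero (hL : 2 ≤ L) (hτ : (τ : ℕ) = e + 2) (hσ : (σ : ℕ) = e + 1) (hμτ : μ ≠ τ) (hμσ : μ ≠ σ) :
    vhSAt (toSite (ctrOff (e + 3) L)) (e + 2) L rfl σ (toSite (ctrOff (e + 3) L)) (toSite (ctrOff (e + 3) L)) 0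
      (Sum.inl τ) (Sum.inr μ) ≠ 0 := by
  have hoff : off L (0 : Site (e + 3)) = 0 := by funext i; simp [off]
  have hblk : blk L (0 : Site (e + 3)) = 0 := by funext i; simp [blk]
  unfold vhSAt
  rw [packVH_inl_inr, if_pos hoff, hblk]
  exact vhKerAt_ctr_ne_zero hL hτ hσ hμτ hμσ

/-- [folklore] **EXISTENTIAL FORM** in the binder shape of an2's `no_twin_border_model`: for every `2 ≤ L` and every
`d = e + 2 ≥ 2` there are `κ′ ≠ α`, `m ≠ α`, `u u′ z` with `vhSAt ρ_c d L rfl κ′ u′ u z (inl α) (inr m) ≠ 0`. -/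
theorem exists_vhSAt_ctr_ne_zero (e : ℕ) {L : ℕ} (hL : 2 ≤ L) :
    ∃ (α κ' m : Fin (e + 3)) (u u' z : Site (e + 3)), κ' ≠ α ∧ m ≠ α ∧
      vhSAt (toSite (ctrOff (e + 3) L)) (e + 2) L rfl κ' u' u z (Sum.inl α) (Sum.inr m) ≠ 0 := by
  refine ⟨Fin.last (e + 2), ⟨e + 1, by omega⟩, 0, toSite (ctrOff (e + 3) L), toSite (ctrOff (e + 3) L), 0, ?_, ?_,
    vhSAt_ctr_ne_zero hL (Fin.val_last _) rfl ?_ ?_⟩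
  all_goals intro h; have := congrArg Fin.val h; simp at this

/-- [folklore] **THE WALL'S DIMENSION `d = 3`** (node-5 dimension `4`): `α = 3`, `κ′ = 2`, `m = 0`, `u = u′ = ρ_c`, `z = 0`. -/
theorem vhSAt_ctr_ne_zero_three {L : ℕ} (hL : 2 ≤ L) :
    vhSAt (toSite (ctrOff 4 L)) 3 L rfl 2 (toSite (ctrOff 4 L)) (toSite (ctrOff 4 L)) 0 (Sum.inl 3) (Sum.inr 0) ≠ 0 :=
  vhSAt_ctr_ne_zero (e := 1) (τ := 3) (σ := 2) (μ := 0) hL rfl rfl (by decide) (by decide)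

end Witness

/-! ## §4 The level-0 pure table of the W-literal and the kernel form of I-d1ref11-1 -/

section NoTwin

open Literature.MathematicalPhysics.QuantumFieldTheory.Balaban1983to89.Beta.ExpKernelCalculus (MKer)
open Literature.MathematicalPhysics.QuantumFieldTheory.Balaban1983to89.Beta.PolarizationSign (reflSign)
open Literature.MathematicalPhysics.QuantumFieldTheory.Balaban1983to89.Beta.KernelReflection (refK)
open Literature.MathematicalPhysics.QuantumFieldTheory.Balaban1983to89.Beta.ResolventReflection (bref)
open Literature.MathematicalPhysics.QuantumFieldTheory.Balaban1983to89.Beta.OneStepResolventKernel (Fib)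
open Summit.QuantumFields.BalabanUV.Beta.TameKernelCalculus (trK)
open Summit.QuantumFields.BalabanUV.Beta.ChartConjugation (conjW)
open Summit.QuantumFields.BalabanUV.Beta.BorderedHessian (sgnK diagK ctGen bhKStepAt)
open Literature.MathematicalPhysics.QuantumFieldTheory.Balaban1983to89.Beta.BalabanStepJetsSucc (wVH)
open Literature.MathematicalPhysics.QuantumFieldTheory.Balaban1983to89.Beta.BalabanStepW2 (wB2)
open Summit.QuantumFields.BalabanUV.Beta.BorderedHessian (stepScale)
open Summit.QuantumFields.BalabanUV.Beta.KernelWardLevels (stepScale_zero)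
open Summit.QuantumFields.BalabanUV.Beta.SpineRooted (SpureRecAt SpureRecAt_zero_level wVH_zero)
open Summit.QuantumFields.BalabanUV.Beta.SecondOrderBorderNoModel (no_twin_border_model)

variable {e L : ℕ} {τ σ μ : Fin (e + 3)}

/-- [folklore] **THE BORDER ENTRIES OF THE LEVEL-0 PURE TABLE ARE `cVH` TIMES THOSE OF `vhSAt`** (the stripped Wilson table `wilsonA`
vanishes on every block touching a multiplier leg): any root, any slots. -/
theorem SpureRecAt_zero_inl_inr [NeZero L] (ρ : Fin (e + 3) → ℤ) (cE cVH cΛ : ℝ) (κ' : Fin (e + 3))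
    (u' x z : Fin (e + 3) → ℤ) (α m : Fin (e + 3)) :
    SpureRecAt (e + 2) L ρ cE cVH cΛ 0 κ' u' x z (Sum.inl α) (Sum.inr m) =
      cVH * vhSAt ρ (e + 2) L rfl κ' u' x z (Sum.inl α) (Sum.inr m) := by
  simp only [SpureRecAt_zero_level, Pi.add_apply, Pi.smul_apply, smul_eq_mul]
  show cE * 0 + _ = _
  rw [mul_zero, zero_add]

/-- [folklore] **THE LEVEL-0 PURE TABLE HAS A NON-ZERO BORDER ENTRY** at the centred root (`2 ≤ L`, `cVH ≠ 0`):
`SpureRecAt (e+2) L ρ_c cE cVH cΛ 0 σ ρ_c ρ_c 0 (inl τ) (inr μ) ≠ 0` — the `hne` input of `no_twin_border_model` at `j = 0`, `α = τ`. -/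
theorem SpureRecAt_zero_ctr_ne_zero [NeZero L] (hL : 2 ≤ L) (hτ : (τ : ℕ) = e + 2) (hσ : (σ : ℕ) = e + 1) (hμτ : μ ≠ τ)
    (hμσ : μ ≠ σ) (cE cΛ : ℝ) {cVH : ℝ} (hcVH : cVH ≠ 0) :
    SpureRecAt (e + 2) L (toSite (ctrOff (e + 3) L)) cE cVH cΛ 0 σ (toSite (ctrOff (e + 3) L)) (toSite (ctrOff (e + 3) L)) 0
      (Sum.inl τ) (Sum.inr μ) ≠ 0 := by
  rw [SpureRecAt_zero_inl_inr]
  exact mul_ne_zero hcVH (vhSAt_ctr_ne_zero hL hτ hσ hμτ hμσ)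

/-- [folklore] The wall's `d = 3` instance of the previous lemma (`α = 3`, `κ′ = 2`, `m = 0`, `u = u′ = ρ_c`, `z = 0`). -/
theorem SpureRecAt_zero_ctr_ne_zero_three {L : ℕ} [NeZero L] (hL : 2 ≤ L) (cE cΛ : ℝ) {cVH : ℝ} (hcVH : cVH ≠ 0) :
    SpureRecAt 3 L (toSite (ctrOff 4 L)) cE cVH cΛ 0 2 (toSite (ctrOff 4 L)) (toSite (ctrOff 4 L)) 0 (Sum.inl 3) (Sum.inr 0) ≠ 0 :=
  SpureRecAt_zero_ctr_ne_zero (e := 1) (τ := 3) (σ := 2) (μ := 0) hL rfl rfl (by decide) (by decide) cE cΛ hcVH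

/-- [folklore] **NO TWIN MODEL OF THE BORDER SOCKET AT LEVEL 0 (I-d1ref11-1 in the kernel)**: for `2 ≤ L`, `cVH ≠ 0`, `γ 0 ≠ 0`, a
border-TWIN second-order table `vh₂S` and ANY coefficient `b`, there is NO row-parity-odd residual `RBα` satisfying both border blocks
(hBfm)/(hBmf) of the hR END's border letter at `(j, α) = (0, τ)` (root `ρ_c`, letters `SpureRecAt 0`, kernel `bhKStepAt 0`, canonical
symbols `γ_0·ctGen`, `γ_0²·ctGen⊗ctGen`) — an2's `no_twin_border_model` fed with the §3 witness. -/
theorem no_twin_border_model_zero [NeZero L] (hL : 2 ≤ L) (hτ : (τ : ℕ) = e + 2) (hσ : (σ : ℕ) = e + 1) (hμτ : μ ≠ τ)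
    (hμσ : μ ≠ σ) (cE cΛ : ℝ) {cVH : ℝ} (hcVH : cVH ≠ 0) (γ : ℕ → ℝ) (hγ : γ 0 ≠ 0) (b : ℝ)
    {vh₂S : Fin (e + 3) → (Fin (e + 3) → ℤ) → Fin (e + 3) → (Fin (e + 3) → ℤ) → MKer (e + 3) (Fib (e + 2))}
    (hBtw : ∀ κ u κ' u' (x z : Fin (e + 3) → ℤ) (β m : Fin (e + 3)),
      vh₂S κ u κ' u' z x (Sum.inr m) (Sum.inl β) = vh₂S κ u κ' u' x z (Sum.inl β) (Sum.inr m)) :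
    ¬ ∃ RBα : Fin (e + 3) → (Fin (e + 3) → ℤ) → Fin (e + 3) → (Fin (e + 3) → ℤ) → MKer (e + 3) (Fib (e + 2)),
      (∀ κ u κ' u', trK (RBα κ u κ' u') = -sgnK (RBα κ u κ' u')) ∧
      (∀ κ u κ' u' (x z : Fin (e + 3) → ℤ) (β m : Fin (e + 3)),
        (b • vh₂S κ (bref τ κ u) κ' (bref τ κ' u')) x z (Sum.inl β) (Sum.inr m) =
          ((reflSign τ κ * reflSign τ κ') • refK (ResolventReflection.Φ (d := e + 2) L τ) (b • vh₂S κ u κ' u' +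
            conjW (bhKStepAt (e + 2) (toSite (ctrOff (e + 3) L)) L 0)
              (SpureRecAt (e + 2) L (toSite (ctrOff (e + 3) L)) cE cVH cΛ 0 κ u)
              (SpureRecAt (e + 2) L (toSite (ctrOff (e + 3) L)) cE cVH cΛ 0 κ' u')
              (diagK fun p c => γ 0 * ctGen (e + 2) τ L κ u p c) (diagK fun p c => γ 0 * ctGen (e + 2) τ L κ' u' p c)
              (diagK fun p c => γ 0 ^ 2 * (ctGen (e + 2) τ L κ u p c * ctGen (e + 2) τ L κ' u' p c)) + RBα κ u κ' u'))
            x z (Sum.inl β) (Sum.inr m)) ∧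
      (∀ κ u κ' u' (x z : Fin (e + 3) → ℤ) (m β : Fin (e + 3)),
        (b • vh₂S κ (bref τ κ u) κ' (bref τ κ' u')) x z (Sum.inr m) (Sum.inl β) =
          ((reflSign τ κ * reflSign τ κ') • refK (ResolventReflection.Φ (d := e + 2) L τ) (b • vh₂S κ u κ' u' +
            conjW (bhKStepAt (e + 2) (toSite (ctrOff (e + 3) L)) L 0)
              (SpureRecAt (e + 2) L (toSite (ctrOff (e + 3) L)) cE cVH cΛ 0 κ u)
              (SpureRecAt (e + 2) L (toSite (ctrOff (e + 3) L)) cE cVH cΛ 0 κ' u')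
              (diagK fun p c => γ 0 * ctGen (e + 2) τ L κ u p c) (diagK fun p c => γ 0 * ctGen (e + 2) τ L κ' u' p c)
              (diagK fun p c => γ 0 ^ 2 * (ctGen (e + 2) τ L κ u p c * ctGen (e + 2) τ L κ' u' p c)) + RBα κ u κ' u'))
            x z (Sum.inr m) (Sum.inl β)) := by
  have hστ : σ ≠ τ := fun h => by have := congrArg Fin.val h; omega
  exact no_twin_border_model cE cVH cΛ γ b (by omega) (ctrOff_mem_box (by omega)) 0 τ hγ hBtw hστ hμτ
    (SpureRecAt_zero_ctr_ne_zero hL hτ hσ hμτ hμσ cE cΛ hcVH)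

/-- [folklore] **THE WALL'S `d = 3` INSTANCE** (`α = 3`, witness legs `κ′ = 2`, `m = 0`): no twin model of the border socket at
level `0` for the centred root in four dimensions, any `2 ≤ L`, `cVH ≠ 0`, `γ 0 ≠ 0`. -/
theorem no_twin_border_model_zero_three {L : ℕ} [NeZero L] (hL : 2 ≤ L) (cE cΛ : ℝ) {cVH : ℝ} (hcVH : cVH ≠ 0)
    (γ : ℕ → ℝ) (hγ : γ 0 ≠ 0) (b : ℝ)
    {vh₂S : Fin 4 → (Fin 4 → ℤ) → Fin 4 → (Fin 4 → ℤ) → MKer 4 (Fib 3)}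
    (hBtw : ∀ κ u κ' u' (x z : Fin 4 → ℤ) (β m : Fin 4),
      vh₂S κ u κ' u' z x (Sum.inr m) (Sum.inl β) = vh₂S κ u κ' u' x z (Sum.inl β) (Sum.inr m)) :
    ¬ ∃ RBα : Fin 4 → (Fin 4 → ℤ) → Fin 4 → (Fin 4 → ℤ) → MKer 4 (Fib 3),
      (∀ κ u κ' u', trK (RBα κ u κ' u') = -sgnK (RBα κ u κ' u')) ∧
      (∀ κ u κ' u' (x z : Fin 4 → ℤ) (β m : Fin 4),
        (b • vh₂S κ (bref 3 κ u) κ' (bref 3 κ' u')) x z (Sum.inl β) (Sum.inr m) =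
          ((reflSign (3 : Fin 4) κ * reflSign (3 : Fin 4) κ') • refK (ResolventReflection.Φ (d := 3) L 3) (b • vh₂S κ u κ' u' +
            conjW (bhKStepAt 3 (toSite (ctrOff 4 L)) L 0)
              (SpureRecAt 3 L (toSite (ctrOff 4 L)) cE cVH cΛ 0 κ u) (SpureRecAt 3 L (toSite (ctrOff 4 L)) cE cVH cΛ 0 κ' u')
              (diagK fun p c => γ 0 * ctGen 3 3 L κ u p c) (diagK fun p c => γ 0 * ctGen 3 3 L κ' u' p c)
              (diagK fun p c => γ 0 ^ 2 * (ctGen 3 3 L κ u p c * ctGen 3 3 L κ' u' p c)) + RBα κ u κ' u'))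
            x z (Sum.inl β) (Sum.inr m)) ∧
      (∀ κ u κ' u' (x z : Fin 4 → ℤ) (m β : Fin 4),
        (b • vh₂S κ (bref 3 κ u) κ' (bref 3 κ' u')) x z (Sum.inr m) (Sum.inl β) =
          ((reflSign (3 : Fin 4) κ * reflSign (3 : Fin 4) κ') • refK (ResolventReflection.Φ (d := 3) L 3) (b • vh₂S κ u κ' u' +
            conjW (bhKStepAt 3 (toSite (ctrOff 4 L)) L 0)
              (SpureRecAt 3 L (toSite (ctrOff 4 L)) cE cVH cΛ 0 κ u) (SpureRecAt 3 L (toSite (ctrOff 4 L)) cE cVH cΛ 0 κ' u')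
              (diagK fun p c => γ 0 * ctGen 3 3 L κ u p c) (diagK fun p c => γ 0 * ctGen 3 3 L κ' u' p c)
              (diagK fun p c => γ 0 ^ 2 * (ctGen 3 3 L κ u p c * ctGen 3 3 L κ' u' p c)) + RBα κ u κ' u'))
            x z (Sum.inr m) (Sum.inl β)) :=
  no_twin_border_model_zero (e := 1) (τ := 3) (σ := 2) (μ := 0) hL rfl rfl (by decide) (by decide) cE cΛ hcVH γ hγ b hBtw

/-- [folklore] **NO TWIN MODEL OF THE END's BORDER SOCKET — EVERY WALL `2 ≤ Lc`** (the `∀ Lc` form of an2's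
`SecondOrderBorderNoModelWitness.final_border_socket_no_twin_model_Lc3`, same statement with `3 ↦ Lc`): for every `cΛ`, `cB`, the wall's `γ`
(`γ_j = −(Lc⁸/2)·wVH j/(stepScale j·Lc⁴)`), EVERY border-twin `vh₂S` and every family `RB` with parity-odd rows, the two border blocks (hBfm)/(hBmf)
of `SpineRooted.axisReflectionCovariant_flipK_TbalOf_JsRecWAtOf_of_letters_final` (all levels `j`, all axes `α`) cannot both hold — they fail at
`j = 0`, `α = 3` by `no_twin_border_model_zero_three`. -/
theorem final_border_socket_no_twin_model {Lc : ℕ} [NeZero Lc] (hLc : 2 ≤ Lc) (cΛ cB : ℝ) (γ : ℕ → ℝ)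
    (hγ : ∀ j, γ j = -((Lc : ℝ) ^ 8 / 2) * wVH 3 Lc j / (stepScale 3 Lc j * (Lc : ℝ) ^ 4))
    {vh₂S : Fin 4 → (Fin 4 → ℤ) → Fin 4 → (Fin 4 → ℤ) → MKer 4 (Fib 3)}
    (hBtw : ∀ κ u κ' u' (x z : Fin 4 → ℤ) (β m : Fin 4), vh₂S κ u κ' u' z x (Sum.inr m) (Sum.inl β) = vh₂S κ u κ' u' x z (Sum.inl β) (Sum.inr m))
    (RB : ℕ → Fin 4 → Fin 4 → (Fin 4 → ℤ) → Fin 4 → (Fin 4 → ℤ) → MKer 4 (Fib 3))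
    (hRBp : ∀ (j : ℕ) (α : Fin 4) κ u κ' u', trK (RB j α κ u κ' u') = -sgnK (RB j α κ u κ' u'))
    (hBfm : ∀ (j : ℕ) (α : Fin 4) κ u κ' u' (x z : Fin 4 → ℤ) (β m : Fin 4),
      ((cB * wB2 3 Lc j) • vh₂S κ (bref α κ u) κ' (bref α κ' u')) x z (Sum.inl β) (Sum.inr m) =
        ((reflSign α κ * reflSign α κ') • refK (ResolventReflection.Φ (d := 3) Lc α) ((cB * wB2 3 Lc j) • vh₂S κ u κ' u' +
          conjW (bhKStepAt 3 (toSite (ctrOff 4 Lc)) Lc j)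
            (SpureRecAt 3 Lc (toSite (ctrOff 4 Lc)) ((Lc : ℝ) ^ 4) (-((Lc : ℝ) ^ 8 / 2)) cΛ j κ u)
            (SpureRecAt 3 Lc (toSite (ctrOff 4 Lc)) ((Lc : ℝ) ^ 4) (-((Lc : ℝ) ^ 8 / 2)) cΛ j κ' u')
            (diagK fun p c => γ j * ctGen 3 α Lc κ u p c) (diagK fun p c => γ j * ctGen 3 α Lc κ' u' p c)
            (diagK fun p c => γ j ^ 2 * (ctGen 3 α Lc κ u p c * ctGen 3 α Lc κ' u' p c)) + RB j α κ u κ' u')) x z (Sum.inl β) (Sum.inr m))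
    (hBmf : ∀ (j : ℕ) (α : Fin 4) κ u κ' u' (x z : Fin 4 → ℤ) (m β : Fin 4),
      ((cB * wB2 3 Lc j) • vh₂S κ (bref α κ u) κ' (bref α κ' u')) x z (Sum.inr m) (Sum.inl β) =
        ((reflSign α κ * reflSign α κ') • refK (ResolventReflection.Φ (d := 3) Lc α) ((cB * wB2 3 Lc j) • vh₂S κ u κ' u' +
          conjW (bhKStepAt 3 (toSite (ctrOff 4 Lc)) Lc j)
            (SpureRecAt 3 Lc (toSite (ctrOff 4 Lc)) ((Lc : ℝ) ^ 4) (-((Lc : ℝ) ^ 8 / 2)) cΛ j κ u)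
            (SpureRecAt 3 Lc (toSite (ctrOff 4 Lc)) ((Lc : ℝ) ^ 4) (-((Lc : ℝ) ^ 8 / 2)) cΛ j κ' u')
            (diagK fun p c => γ j * ctGen 3 α Lc κ u p c) (diagK fun p c => γ j * ctGen 3 α Lc κ' u' p c)
            (diagK fun p c => γ j ^ 2 * (ctGen 3 α Lc κ u p c * ctGen 3 α Lc κ' u' p c)) + RB j α κ u κ' u')) x z (Sum.inr m) (Sum.inl β)) :
    False := by
  have hL0 : (Lc : ℝ) ≠ 0 := Nat.cast_ne_zero.2 (by omega)
  have hγ0 : γ 0 ≠ 0 := by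
    rw [hγ 0, wVH_zero, stepScale_zero, mul_one, one_mul]
    exact div_ne_zero (neg_ne_zero.2 (div_ne_zero (pow_ne_zero _ hL0) two_ne_zero)) (pow_ne_zero _ hL0)
  have hcVH : (-((Lc : ℝ) ^ 8 / 2)) ≠ 0 := neg_ne_zero.2 (div_ne_zero (pow_ne_zero _ hL0) two_ne_zero)
  exact no_twin_border_model_zero_three hLc ((Lc : ℝ) ^ 4) cΛ hcVH γ hγ0 (cB * wB2 3 Lc 0) hBtw
    ⟨RB 0 3, hRBp 0 3, hBfm 0 3, hBmf 0 3⟩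

end NoTwin

end Summit.QuantumFields.BalabanUV.Beta.AveragingBorderWitness
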